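import Summits.Ventures.PercRepro.RankLevelSetRuleQSixFullRows

/-!
# PercRepro — (R̂) ON THE CELL FAMILY `k = 6` FROM THE WHOLE-DIAGONAL PAIRING (p4, gen 22; C-044; paper
proofs/P4-CELL-THREE.md §11.12)

`rhat_six_of_full (q m) (5 ≤ q − m) (m ≤ q) (h6) : phiK (q + 6) q ≤ rhat q 6 m`, where `h6` is the row `J = 1` of the pairing of the
`i = 0` row of `rhat_sub_phiK_eq` with the WHOLE diagonal `J + 5` (its five terms `i = 5 … 1`): with `u = q − m`,
`(u+2)(u+3)(u+4)(u+5)·Π_{i<5}(q+2+i) ≤ [6(u+2)(u+3)(u+4)(u+5) + 15(u+3)(u+4)(u+5)(m−1) + 20(u+4)(u+5)(m−1)(m−2) + 15(u+5)(m−1)(m−2)(m−3) + 6(m−1)(m−2)(m−3)(m−4)]·Π_{i<5}(u+2+i)`.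
The rows `J ≥ 2` follow from `J = 1` (RankLevelSetRuleQSixFullRows: `six_row_step` through `row_transfer`, with the step
polynomials of RankLevelSetRuleQSixFullPoly — 90 / 35 / 35 / 35 non-negative coefficients), the pairing is `pairing_choose_six`,
and the assembly keeps the whole diagonal `Ioo 0 6 = {1, …, 5}`.  REGIME: `u ≥ u₀(m)` with `u₀ = 5` for `m ≤ 31` and
`u₀(100) = 24` (six6.py), i.e. `#P ≲ 0.81·q`; with night-1's slice `u = 4` (every `q`), the failures at `u = 2` (`q ≥ 1002`) and
`u = 3` (`q ≥ 264`, first failure `264`), the map of the family `k = 6` is: `u ∈ {0, 1, 4}` every `q`, `u ∈ {2, 3}` fail for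
large `q`, `u ≥ 5` covered for `#P ≲ 0.81·q`; open: the band `0.81·q ≲ #P ≤ q − 5`.  A certified point:
`rhat_hundred_six_eighty : phiK (100 + 6) 100 ≤ rhat 100 6 80`; the point `(100, 6, 85)` is refused.  Axioms: standard.
-/

namespace PercRepro

open Finset

/-- The whole-diagonal pairing at `k = 6` in `ℚ`, every `J`. -/
lemma pair_term_six (u m J : ℕ) (hu : 5 ≤ u)
    (h6 : (u + 2) * (u + 3) * (u + 4) * (u + 5) * ∏ i ∈ range 5, (u + m + 2 + i)
        ≤ (6 * (u + 2) * (u + 3) * (u + 4) * (u + 5) + 15 * (u + 3) * (u + 4) * (u + 5) * (m - 1) + 20 * (u + 4) * (u + 5) * (m - 1) * (m - 2)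
            + 15 * (u + 5) * (m - 1) * (m - 2) * (m - 3) + 6 * (m - 1) * (m - 2) * (m - 3) * (m - 4)) * ∏ i ∈ range 5, (u + 2 + i)) :
    (m.choose (J + 1) : ℚ) * (1 / ((u + m + (J + 1)).choose (J + 1) : ℚ))
      ≤ (1 / ((u + m + (6 + J)).choose (6 + J) : ℚ))
        * (((u + 6).choose 5 : ℚ) * (m.choose (J + 1) : ℚ) + ((u + 6).choose 4 : ℚ) * (m.choose (J + 2) : ℚ)
          + ((u + 6).choose 3 : ℚ) * (m.choose (J + 3) : ℚ) + ((u + 6).choose 2 : ℚ) * (m.choose (J + 4) : ℚ)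
          + ((u + 6).choose 1 : ℚ) * (m.choose (J + 5) : ℚ)) := by
  rcases Nat.lt_or_ge m (J + 1) with hJm | hJm
  · rw [Nat.choose_eq_zero_of_lt hJm]
    push_cast
    rw [zero_mul]
    positivity
  · have h := pairing_choose_six u m (J + 1) hu (by omega) hJm h6
    rw [show u + m + (J + 1) + 5 = u + m + (6 + J) by omega, show J + 1 + 5 = 6 + J by omega,
      show J + 1 + 1 = J + 2 by ring, show J + 1 + 2 = J + 3 by ring, show J + 1 + 3 = J + 4 by ring,
      show J + 1 + 4 = J + 5 by ring] at h
    have hX : (0 : ℚ) < ((u + m + (J + 1)).choose (J + 1) : ℚ) := by exact_mod_cast Nat.choose_pos (by omega)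
    have hY : (0 : ℚ) < ((u + m + (6 + J)).choose (6 + J) : ℚ) := by exact_mod_cast Nat.choose_pos (by omega)
    have h' : ((m.choose (J + 1) : ℕ) : ℚ) * ((u + m + (6 + J)).choose (6 + J) : ℚ)
        ≤ ((((u + 6).choose 5 * m.choose (J + 1) + (u + 6).choose 4 * m.choose (J + 2) + (u + 6).choose 3 * m.choose (J + 3)
          + (u + 6).choose 2 * m.choose (J + 4) + (u + 6).choose 1 * m.choose (J + 5) : ℕ)) : ℚ)
          * ((u + m + (J + 1)).choose (J + 1) : ℚ) := by
      exact_mod_cast h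
    push_cast at h'
    rw [mul_one_div, one_div_mul_eq_div, div_le_div_iff₀ hX hY]
    linarith

/-- **(R̂) ON THE CELL FAMILY `k = 6` FROM THE WHOLE-DIAGONAL PAIRING** (`u = q − #P ≥ 5`). -/
theorem rhat_six_of_full (q m : ℕ) (hu : 5 ≤ q - m) (hm : m ≤ q)
    (h6 : (q - m + 2) * (q - m + 3) * (q - m + 4) * (q - m + 5) * ∏ i ∈ range 5, (q + 2 + i)
        ≤ (6 * (q - m + 2) * (q - m + 3) * (q - m + 4) * (q - m + 5) + 15 * (q - m + 3) * (q - m + 4) * (q - m + 5) * (m - 1) + 20 * (q - m + 4) * (q - m + 5) * (m - 1) * (m - 2)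
            + 15 * (q - m + 5) * (m - 1) * (m - 2) * (m - 3) + 6 * (m - 1) * (m - 2) * (m - 3) * (m - 4)) * ∏ i ∈ range 5, (q - m + 2 + i)) :
    phiK (q + 6) q ≤ rhat q 6 m := by
  rw [rhat_ge_phiK_iff_untrunc q 6 m (by omega) (by omega) hm]
  obtain ⟨u, rfl⟩ : ∃ u, q = u + m := ⟨q - m, by omega⟩
  rw [Nat.add_sub_cancel] at h6 hu
  have hterm : ∀ J' i, i ≤ J' →
      (if i ≤ J' ∧ J' - i ≤ m then ((u + m + 6 - m).choose i : ℚ) * (m.choose (J' - i) : ℚ) else 0)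
        = ((u + 6).choose i : ℚ) * (m.choose (J' - i) : ℚ) := by
    intro J' i hi
    rw [show u + m + 6 - m = u + 6 by omega]
    by_cases hm' : J' - i ≤ m
    · rw [if_pos ⟨hi, hm'⟩]
    · rw [if_neg (fun h => hm' h.2), Nat.choose_eq_zero_of_lt (by omega : m < J' - i)]
      simp
  have hN : ∀ J ∈ range m,
      (1 / ((u + m + (6 + J)).choose (6 + J) : ℚ)) * (((u + 6).choose 5 : ℚ) * (m.choose (J + 1) : ℚ) + ((u + 6).choose 4 : ℚ) * (m.choose (J + 2) : ℚ)
          + ((u + 6).choose 3 : ℚ) * (m.choose (J + 3) : ℚ) + ((u + 6).choose 2 : ℚ) * (m.choose (J + 4) : ℚ)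
          + ((u + 6).choose 1 : ℚ) * (m.choose (J + 5) : ℚ))
        ≤ (1 / ((u + m + (6 + J)).choose (6 + J) : ℚ)) * ∑ i ∈ Ioo 0 6,
            (if i ≤ 6 + J ∧ 6 + J - i ≤ m then ((u + m + 6 - m).choose i : ℚ) * (m.choose (6 + J - i) : ℚ) else 0) := by
    intro J _
    refine mul_le_mul_of_nonneg_left ?_ (by positivity)
    have hsub : ({1, 2, 3, 4, 5} : Finset ℕ) ⊆ Ioo 0 6 := by
      intro i hi
      simp only [Finset.mem_insert, Finset.mem_singleton] at hi
      rw [Finset.mem_Ioo]; omega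
    refine le_trans (le_of_eq ?_) (Finset.sum_le_sum_of_subset_of_nonneg hsub (fun i _ _ => by split_ifs <;> positivity))
    rw [Finset.sum_insert (by simp), Finset.sum_insert (by simp), Finset.sum_insert (by simp), Finset.sum_pair (by norm_num),
      hterm (6 + J) 1 (by omega), hterm (6 + J) 2 (by omega), hterm (6 + J) 3 (by omega), hterm (6 + J) 4 (by omega),
      hterm (6 + J) 5 (by omega), show 6 + J - 1 = J + 5 by omega, show 6 + J - 2 = J + 4 by omega,
      show 6 + J - 3 = J + 3 by omega, show 6 + J - 4 = J + 2 by omega, show 6 + J - 5 = J + 1 by omega]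
    ring
  have hpos : ∑ J ∈ range m, (1 / ((u + m + (6 + J)).choose (6 + J) : ℚ)) * (((u + 6).choose 5 : ℚ) * (m.choose (J + 1) : ℚ) + ((u + 6).choose 4 : ℚ) * (m.choose (J + 2) : ℚ)
          + ((u + 6).choose 3 : ℚ) * (m.choose (J + 3) : ℚ) + ((u + 6).choose 2 : ℚ) * (m.choose (J + 4) : ℚ)
          + ((u + 6).choose 1 : ℚ) * (m.choose (J + 5) : ℚ))
      ≤ ∑ J' ∈ Ico 6 (6 + m), (1 / ((u + m + J').choose J' : ℚ)) * ∑ i ∈ Ioo 0 6,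
            (if i ≤ J' ∧ J' - i ≤ m then ((u + m + 6 - m).choose i : ℚ) * (m.choose (J' - i) : ℚ) else 0) := by
    rw [Finset.sum_Ico_eq_sum_range, show 6 + m - 6 = m by omega]
    exact Finset.sum_le_sum hN
  rw [sum_Ioo_nat, show 6 - (0 + 1) = 5 by omega]
  refine le_trans ?_ hpos
  set f : ℕ → ℚ := fun J => (m.choose (0 + 1 + J) : ℚ) * (1 / ((u + m + (0 + 1 + J)).choose (0 + 1 + J) : ℚ)) with hf
  set g : ℕ → ℚ := fun J => (1 / ((u + m + (6 + J)).choose (6 + J) : ℚ)) * (((u + 6).choose 5 : ℚ) * (m.choose (J + 1) : ℚ) + ((u + 6).choose 4 : ℚ) * (m.choose (J + 2) : ℚ)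
          + ((u + 6).choose 3 : ℚ) * (m.choose (J + 3) : ℚ) + ((u + 6).choose 2 : ℚ) * (m.choose (J + 4) : ℚ)
          + ((u + 6).choose 1 : ℚ) * (m.choose (J + 5) : ℚ)) with hg
  have hfg : ∀ J, f J ≤ g J := by
    intro J
    simp only [hf, hg, show 0 + 1 + J = J + 1 by ring]
    exact pair_term_six u m J hu h6
  have hg0 : ∀ J, m ≤ J → g J = 0 := by
    intro J hJ
    simp only [hg]
    rw [Nat.choose_eq_zero_of_lt (by omega : m < J + 1), Nat.choose_eq_zero_of_lt (by omega : m < J + 2),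
      Nat.choose_eq_zero_of_lt (by omega : m < J + 3), Nat.choose_eq_zero_of_lt (by omega : m < J + 4),
      Nat.choose_eq_zero_of_lt (by omega : m < J + 5)]
    simp
  have hgnn : ∀ J, 0 ≤ g J := by
    intro J
    simp only [hg]
    positivity
  calc ∑ J ∈ range 5, f J ≤ ∑ J ∈ range 5, g J := Finset.sum_le_sum (fun J _ => hfg J)
    _ ≤ ∑ J ∈ range (5 + m), g J :=
        Finset.sum_le_sum_of_subset_of_nonneg
          (fun x hx => by rw [Finset.mem_range] at hx ⊢; omega) (fun J _ _ => hgnn J)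
    _ = ∑ J ∈ range m, g J := by
        rw [← Finset.sum_range_add_sum_Ico _ (show m ≤ 5 + m by omega)]
        rw [Finset.sum_eq_zero (fun J hJ => hg0 J (Finset.mem_Ico.1 hJ).1), add_zero]

variable {α : Type} (M : Matroid α) [M.Finite]

/-- **Rule Q pays `Φ(q+6, q)` to every member of the cell `(q+6, q)` whose flat part satisfies the whole-diagonal
condition** (`u = q − #P ≥ 5`). -/
theorem ruleQRecv_six_of_full {q : ℕ} (hE : M.E.ncard = (q + 6) + q)
    {Z : Set α} (hZ : Z ∈ cellMembers M (q + 6) q) (hu : 5 ≤ q - (flatPart M Z).ncard)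
    (h6 : (q - (flatPart M Z).ncard + 2) * (q - (flatPart M Z).ncard + 3) * (q - (flatPart M Z).ncard + 4) * (q - (flatPart M Z).ncard + 5) * ∏ i ∈ range 5, (q + 2 + i)
        ≤ (6 * (q - (flatPart M Z).ncard + 2) * (q - (flatPart M Z).ncard + 3) * (q - (flatPart M Z).ncard + 4) * (q - (flatPart M Z).ncard + 5) + 15 * (q - (flatPart M Z).ncard + 3) * (q - (flatPart M Z).ncard + 4) * (q - (flatPart M Z).ncard + 5) * ((flatPart M Z).ncard - 1) + 20 * (q - (flatPart M Z).ncard + 4) * (q - (flatPart M Z).ncard + 5) * ((flatPart M Z).ncard - 1) * ((flatPart M Z).ncard - 2)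
            + 15 * (q - (flatPart M Z).ncard + 5) * ((flatPart M Z).ncard - 1) * ((flatPart M Z).ncard - 2) * ((flatPart M Z).ncard - 3) + 6 * ((flatPart M Z).ncard - 1) * ((flatPart M Z).ncard - 2) * ((flatPart M Z).ncard - 3) * ((flatPart M Z).ncard - 4)) * ∏ i ∈ range 5, (q - (flatPart M Z).ncard + 2 + i)) :
    phiK (q + 6) q ≤ ruleQRecv M (q + 6) q Z := by
  refine le_trans ?_ (rhat_le_ruleQRecv M hE hZ)
  have hm : (flatPart M Z).ncard ≤ q := (Nat.lt_of_sub_pos (lt_of_lt_of_le (by norm_num) hu)).le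
  exact rhat_six_of_full q _ hu hm h6

/-- A certified point of the cell `(106, 100)`: `#P = 80` (`u = 20`). -/
theorem rhat_hundred_six_eighty : phiK (100 + 6) 100 ≤ rhat 100 6 80 :=
  rhat_six_of_full 100 80 (by norm_num) (by norm_num) (by decide)

end PercRepro
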